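import Mathlib
import HarnessLib

/-!
# Route `KLProgramme` — crux C4a, S3 brick (B4) «(U1)-LAWS» part 5e: the PRE-CAUSTIC LEVEL LINE ALONG THE DIAGONAL (negative loop levels) — from a DIAGONAL
# MAJORANT of the mixed-sign kernel: `|∫_{lo..hi} w·X·(K s)′(ē s)| ≤ 5·W·X₀·Mρ·lo/max(D,lo)²`, no deformation rows, no flatness number

Cell `gate-hubbard-kl`, seat hubbard-kl-k3c3-p3 (g32; row «implicit-function / monotonicity route for μ(n)»).  Located brick for the (C)-closer lane / the (M4)
assembly of the umklapp first-order ϑ-layer (stub (C) `stub_twoLeg_curvature` of `KLRegimeEngineV17F2`, stmt-HubbardSuperconductivity-20437), memo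
HOME/hubbard-kl-k3c3-p3/U1-CAUSTIC-SUP.md §12 («(U1)-NEG-PRE»).

WHY.  Parts 5b–5d (`…C4aPreCausticLevelLineSplit`, `…C4aFoldBoxPreLawLine`, `…C4aFoldBoxPreLaw`) price the pre-caustic level line for loop levels `e ∈ [lo,hi]`
ABOVE the Fermi level: there the partner line is the ANTI-DIAGONAL `u ≈ D − e`, the finer-line split truncates it at `e ≍ D`, and the one genuine kernel input is the
anti-diagonal flatness number.  For loop levels BELOW the Fermi level (`e = −s`, `s ∈ [lo,hi]`) on the PRE side (`D = ē(0,y) > 0`) the partner line is the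
DIAGONAL `u = ē(−s,y) ≈ D + s` (rate window: `|u − s − D| ≤ s/2`), the split never truncates it, and the kernel `u ↦ K(−s,u)` is the MIXED-SIGN pair kernel.
Its plain envelope `|∂ᵤK| ≤ C/max(s,|u|)²` is NOT enough (it yields a level line `≍ 1/max(D,lo)`, hence `(√max(δ₀,lo))⁻¹` after the loop-angle layer and a
`log(1/lo)` across a pre-side double zero of the offset — not `n`-free).  What suffices — and what the thermal far-far kernel
`[tanh(βu/2) − tanh(βs/2)]/(2(u − s))` satisfies with `ρ(s) ≍ max(1,(β·lo)²)·e^{−βs/2}` — is a DIAGONAL MAJORANT: `ρ ≥ 0` on `[lo,hi]` with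
`|(K s)′ u| ≤ ρ(s)/max(u − s, lo)²` for `u ≥ s/2` and the TAIL LAW `∫_a^hi ρ ≤ Mρ·lo·(lo/a)²` (`a ∈ [lo,hi]`).  Then the level line obeys the (N2) line shape
`A₁·lo/max(D,lo)²` with `A₁ = 5·W·X₀·Mρ` and NO `A₂, A₃` rows: for `s ≤ D` the rate window keeps the partner `≥ D/2` above the diagonal (`4ρ/max(D,lo)²`, mass
`≤ Mρ·lo`), for `s > D` the tail law pays (`ρ/lo²`, mass `≤ Mρ·lo·(lo/max(D,lo))²`).
* §1 **`sq_mul_exp_neg_le_four`** (`y²e^{−y} ≤ 4`, `y ≥ 0`) and **`intervalIntegral_exp_tail_le`**: the model majorant `ρ(s) = R·e^{−κs}` obeys the tail law with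
  `Mρ = 4R/(κ·lo)³` — the hypothesis shape of §2 is the natural currency of an exponentially decaying (thermal) kernel.
* §2 **`abs_intervalIntegral_levelLine_diagonal_le`** (HEADLINE): levels `0 < lo ≤ hi`, diagonal level `D > 0`; kernel rows = the diagonal majorant + tail law;
  weight `|X| ≤ X₀`; profile `0 ≤ w ≤ W`; the partner line `ē` with `|ē s − s − D| ≤ s/2`; the integrand and `ρ` interval-integrable ⟹
  `|∫_{lo..hi} w·X·(K s)′(ē s)| ≤ 5·(W·X₀·Mρ)·(lo/max(D,lo)²)` — the `hF` row of `…C4aPreCausticAngleLayer.intervalIntegral_pre_caustic_angle_le` with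
  `A₁ = 5WX₀Mρ`, `A₂ = A₃ = 0`.
* §3 **`intervalIntegral_le_of_forall_Ioc_left`**: a bound on `∫_t^b f` uniform in `t ∈ (a,c]` holds at `t = a` — carries the `lo`-free laws 4a/4b to the Fermi level.
Pure real analysis; nothing about the model; nothing asserts (C), K3 or superconductivity.
References: FST II CPAM 51 (1998) §3 [cite: FeldmanSalmhoferTrubowitz1998]; Salmhofer 1999 §4.5.3 [cite: Salmhofer1999].
-/

noncomputable section

namespace Summit.HubbardSuperconductivity.HubbardSuperconductivity.Theorems.C4a

set_option linter.dupNamespace false -- summit = problem name (single-conjunct summit), D-0017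

open Real Set MeasureTheory intervalIntegral
open scoped Interval

/-! ## §1 The model majorant: exponential tails obey the tail law -/

/-- `y²·e^{−y} ≤ 4` for `y ≥ 0` (from `e^{y/2} ≥ 1 + y/2`). [folklore] -/
theorem sq_mul_exp_neg_le_four {y : ℝ} (hy : 0 ≤ y) : y ^ 2 * Real.exp (-y) ≤ 4 := by
  have h1 : 1 + y / 2 ≤ Real.exp (y / 2) := by
    have := Real.add_one_le_exp (y / 2); linarith
  have h2 : (1 + y / 2) ^ 2 ≤ Real.exp (y / 2) ^ 2 := pow_le_pow_left₀ (by linarith) h1 2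
  have h3 : Real.exp (y / 2) ^ 2 = Real.exp y := by rw [← Real.exp_nat_mul]; ring_nf
  have h4 : y ^ 2 ≤ 4 * Real.exp y := by nlinarith
  have h5 : Real.exp (-y) * Real.exp y = 1 := by rw [← Real.exp_add]; simp
  have h6 : 0 < Real.exp (-y) := Real.exp_pos _
  nlinarith [mul_le_mul_of_nonneg_left h4 h6.le]

/-- **THE TAIL LAW FOR AN EXPONENTIAL MAJORANT.**  `R ≥ 0`, `κ > 0`, `0 < lo ≤ a`, any `hi`:
`∫_a^hi R·e^{−κs} ds ≤ (4R/(κ·lo)³)·(lo·(lo/a)²)` — the shape of the hypothesis `hρtail` of `abs_intervalIntegral_levelLine_diagonal_le` (with `Mρ = 4R/(κ·lo)³`;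
for the thermal kernel `κ = β/2`, so `Mρ` is a function of `β·lo` only). [folklore] -/
theorem intervalIntegral_exp_tail_le {R κ lo a : ℝ} (hR : 0 ≤ R) (hκ : 0 < κ) (hlo : 0 < lo) (ha : lo ≤ a) (hi : ℝ) :
    ∫ s in a..hi, R * Real.exp (-(κ * s)) ≤ 4 * R / (κ * lo) ^ 3 * (lo * (lo / a) ^ 2) := by
  have ha0 : 0 < a := hlo.trans_le ha
  -- the primitive
  have hderiv : ∀ s ∈ uIcc a hi, HasDerivAt (fun s : ℝ => -(R / κ) * Real.exp (-(κ * s))) (R * Real.exp (-(κ * s))) s := fun s _ => by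
    have hκ0 : κ ≠ 0 := hκ.ne'
    have h0 : HasDerivAt (fun x : ℝ => -(κ * x)) (-(κ * 1)) s := ((hasDerivAt_id s).const_mul κ).neg
    have h3 := h0.exp.const_mul (-(R / κ))
    refine h3.congr_deriv ?_
    field_simp
  have hcont : ContinuousOn (fun s : ℝ => R * Real.exp (-(κ * s))) (uIcc a hi) := by fun_prop
  have hint : IntervalIntegrable (fun s : ℝ => R * Real.exp (-(κ * s))) volume a hi :=
    hcont.intervalIntegrable
  rw [intervalIntegral.integral_eq_sub_of_hasDerivAt hderiv hint]
  have hexp0 : 0 ≤ Real.exp (-(κ * hi)) := (Real.exp_pos _).le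
  have hkey : Real.exp (-(κ * a)) ≤ 4 / (κ * a) ^ 2 := by
    have h := sq_mul_exp_neg_le_four (y := κ * a) (by positivity)
    rw [le_div_iff₀ (by positivity)]
    linarith
  have hRκ : 0 ≤ R / κ := div_nonneg hR hκ.le
  calc -(R / κ) * Real.exp (-(κ * hi)) - -(R / κ) * Real.exp (-(κ * a))
      = R / κ * Real.exp (-(κ * a)) - R / κ * Real.exp (-(κ * hi)) := by ring
    _ ≤ R / κ * Real.exp (-(κ * a)) := by
        have : 0 ≤ R / κ * Real.exp (-(κ * hi)) := mul_nonneg hRκ hexp0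
        linarith
    _ ≤ R / κ * (4 / (κ * a) ^ 2) := mul_le_mul_of_nonneg_left hkey hRκ
    _ = 4 * R / (κ * lo) ^ 3 * (lo * (lo / a) ^ 2) := by field_simp

/-! ## §2 The pre-caustic level line along the diagonal -/

/-- **THE PRE-CAUSTIC LEVEL LINE ALONG THE DIAGONAL** (HEADLINE; see the module docstring).  Levels `0 < lo ≤ hi`; diagonal level `D > 0`; kernel `K s` with the
DIAGONAL MAJORANT `|(K s)′ u| ≤ ρ(s)/max(u − s, lo)²` for `u ≥ s/2`, `ρ ≥ 0` interval-integrable with the tail law `∫_a^hi ρ ≤ Mρ·lo·(lo/a)²` (`a ∈ [lo,hi]`); weight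
`|X| ≤ X₀`; profile `0 ≤ w ≤ W`; the partner line `ē` with `|ē s − s − D| ≤ s/2` on `[lo,hi]`; the integrand interval-integrable.  THEN
`|∫_{lo..hi} w·X·(K s)′(ē s)| ≤ 5·(W·X₀·Mρ)·(lo/max(D,lo)²)`. -/
theorem abs_intervalIntegral_levelLine_diagonal_le {K : ℝ → ℝ → ℝ} {w X eb ρ : ℝ → ℝ} {lo hi D X₀ W Mρ : ℝ}
    (hlo : 0 < lo) (hlohi : lo ≤ hi) (hD : 0 < D)
    (hK1 : ∀ s ∈ Icc lo hi, ∀ u, s / 2 ≤ u → |deriv (K s) u| ≤ ρ s * ((max (u - s) lo)⁻¹ ^ 2))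
    (hρ0 : ∀ s ∈ Icc lo hi, 0 ≤ ρ s) (hρi : IntervalIntegrable ρ volume lo hi)
    (hρtail : ∀ a ∈ Icc lo hi, ∫ s in a..hi, ρ s ≤ Mρ * (lo * (lo / a) ^ 2))
    (hfi : IntervalIntegrable (fun s => w s * X s * deriv (K s) (eb s)) volume lo hi)
    (hw0 : ∀ s ∈ Icc lo hi, 0 ≤ w s) (hwW : ∀ s ∈ Icc lo hi, w s ≤ W) (hX0 : ∀ s ∈ Icc lo hi, |X s| ≤ X₀)
    (hdev : ∀ s ∈ Icc lo hi, |eb s - s - D| ≤ s / 2) :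
    |∫ s in lo..hi, w s * X s * deriv (K s) (eb s)| ≤ 5 * (W * X₀ * Mρ) * (lo / (max D lo) ^ 2) := by
  have hloI : lo ∈ Icc lo hi := left_mem_Icc.2 hlohi
  have hX00 : 0 ≤ X₀ := (abs_nonneg _).trans (hX0 lo hloI)
  have hW0 : 0 ≤ W := (hw0 lo hloI).trans (hwW lo hloI)
  set M : ℝ := max D lo with hM
  have hMlo : lo ≤ M := le_max_right _ _
  have hMpos : 0 < M := hlo.trans_le hMlo
  -- total mass of `ρ`
  have hmass : ∫ s in lo..hi, ρ s ≤ Mρ * lo := by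
    have h := hρtail lo hloI
    rwa [div_self hlo.ne', one_pow, mul_one] at h
  have hMρ0 : 0 ≤ Mρ := by
    have h0 : 0 ≤ ∫ s in lo..hi, ρ s := intervalIntegral.integral_nonneg hlohi fun s hs => hρ0 s hs
    nlinarith
  set f : ℝ → ℝ := fun s => w s * X s * deriv (K s) (eb s) with hf
  -- the partner line sits at least `s/2` above the Fermi level and, for `s ≤ D`, at least `D/2` above the diagonal
  have heb : ∀ s ∈ Icc lo hi, s / 2 ≤ eb s := fun s hs => by
    have h := (abs_le.1 (hdev s hs)).1
    linarith
  -- the core pointwise bound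
  have hcore : ∀ s ∈ Icc lo hi, ∀ B : ℝ, (max (eb s - s) lo)⁻¹ ^ 2 ≤ B → |f s| ≤ W * X₀ * B * ρ s := fun s hs B hB => by
    have hd := hK1 s hs (eb s) (heb s hs)
    have hB0 : 0 ≤ B := le_trans (by positivity) hB
    rw [hf]
    simp only
    rw [abs_mul, abs_mul, abs_of_nonneg (hw0 s hs)]
    have h1 : w s * |X s| ≤ W * X₀ := mul_le_mul (hwW s hs) (hX0 s hs) (abs_nonneg _) hW0
    have h2 : |deriv (K s) (eb s)| ≤ ρ s * B := hd.trans (mul_le_mul_of_nonneg_left hB (hρ0 s hs))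
    calc w s * |X s| * |deriv (K s) (eb s)| ≤ W * X₀ * (ρ s * B) := mul_le_mul h1 h2 (abs_nonneg _) (by positivity)
      _ = W * X₀ * B * ρ s := by ring
  -- regime 1: `s ≤ D` or `D ≤ lo` ⟹ `max(ē − s, lo) ≥ M/2`
  have hpt1 : ∀ s ∈ Icc lo hi, (s ≤ D ∨ D ≤ lo) → |f s| ≤ W * X₀ * (4 / M ^ 2) * ρ s := fun s hs hsD => by
    refine hcore s hs _ ?_
    have hm : M / 2 ≤ max (eb s - s) lo := by
      rcases hsD with h | h
      · rcases le_total D lo with h' | h'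
        · rw [hM, max_eq_right h']; exact le_max_of_le_right (by linarith)
        · rw [hM, max_eq_left h']
          have h2 := (abs_le.1 (hdev s hs)).1
          exact le_max_of_le_left (by linarith)
      · rw [hM, max_eq_right h]; exact le_max_of_le_right (by linarith)
    rw [inv_pow, show (4 : ℝ) / M ^ 2 = ((M / 2) ^ 2)⁻¹ by field_simp; norm_num]
    exact inv_anti₀ (by positivity) (pow_le_pow_left₀ (by positivity) hm 2)
  -- regime 2: always `max(ē − s, lo) ≥ lo`
  have hpt2 : ∀ s ∈ Icc lo hi, |f s| ≤ W * X₀ * (1 / lo ^ 2) * ρ s := fun s hs => by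
    refine hcore s hs _ ?_
    rw [inv_pow, one_div]
    exact inv_anti₀ (by positivity) (pow_le_pow_left₀ hlo.le (le_max_right _ _) 2)
  -- a comparison tool: `|∫_a^b f| ≤ c·∫_a^b ρ` from a pointwise bound on `[a,b] ⊆ [lo,hi]`
  have hcmp : ∀ a b c : ℝ, lo ≤ a → a ≤ b → b ≤ hi → 0 ≤ c → (∀ s ∈ Icc a b, |f s| ≤ c * ρ s) →
      |∫ s in a..b, f s| ≤ c * ∫ s in a..b, ρ s := fun a b c hloa hab hbhi hc hpt => by
    have hsub : uIcc a b ⊆ uIcc lo hi := by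
      rw [uIcc_of_le hab, uIcc_of_le hlohi]; exact Icc_subset_Icc hloa hbhi
    have hfi' : IntervalIntegrable f volume a b := hfi.mono_set hsub
    have hρi' : IntervalIntegrable ρ volume a b := hρi.mono_set hsub
    calc |∫ s in a..b, f s| ≤ ∫ s in a..b, |f s| := intervalIntegral.abs_integral_le_integral_abs hab
      _ ≤ ∫ s in a..b, c * ρ s := intervalIntegral.integral_mono_on hab hfi'.abs (hρi'.const_mul c) fun s hs => hpt s hs
      _ = c * ∫ s in a..b, ρ s := intervalIntegral.integral_const_mul c ρ
  have hRHS0 : 0 ≤ W * X₀ * Mρ * (lo / M ^ 2) := by positivity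
  rcases le_or_gt M hi with hMhi | hMhi
  · -- case A: split the line at `M ∈ [lo,hi]`
    have hMI : M ∈ Icc lo hi := ⟨hMlo, hMhi⟩
    have hfi1 : IntervalIntegrable f volume lo M :=
      hfi.mono_set (by rw [uIcc_of_le hlohi, uIcc_of_le hMlo]; exact Icc_subset_Icc le_rfl hMhi)
    have hfi2 : IntervalIntegrable f volume M hi :=
      hfi.mono_set (by rw [uIcc_of_le hlohi, uIcc_of_le hMhi]; exact Icc_subset_Icc hMlo le_rfl)
    rw [← intervalIntegral.integral_add_adjacent_intervals hfi1 hfi2]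
    -- first piece
    have h1 : |∫ s in lo..M, f s| ≤ W * X₀ * (4 / M ^ 2) * ∫ s in lo..M, ρ s :=
      hcmp lo M _ le_rfl hMlo hMhi (by positivity) fun s hs => hpt1 s ⟨hs.1, hs.2.trans hMhi⟩ (by
        rcases le_total D lo with h | h
        · exact Or.inr h
        · exact Or.inl (hs.2.trans (by rw [hM, max_eq_left h])))
    have hρ1 : ∫ s in lo..M, ρ s ≤ Mρ * lo := by
      refine le_trans ?_ hmass
      refine intervalIntegral.integral_mono_interval le_rfl hMlo hMhi ?_ hρi
      rw [Filter.EventuallyLE, ae_restrict_iff' measurableSet_Ioc]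
      exact ae_of_all _ fun s hs => hρ0 s (Ioc_subset_Icc_self hs)
    -- second piece
    have h2 : |∫ s in M..hi, f s| ≤ W * X₀ * (1 / lo ^ 2) * ∫ s in M..hi, ρ s :=
      hcmp M hi _ hMlo hMhi le_rfl (by positivity) fun s hs => hpt2 s ⟨hMlo.trans hs.1, hs.2⟩
    have hρ2 : ∫ s in M..hi, ρ s ≤ Mρ * (lo * (lo / M) ^ 2) := hρtail M hMI
    have h1' : |∫ s in lo..M, f s| ≤ 4 * (W * X₀ * Mρ) * (lo / M ^ 2) := by
      refine h1.trans ?_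
      have := mul_le_mul_of_nonneg_left hρ1 (by positivity : 0 ≤ W * X₀ * (4 / M ^ 2))
      refine this.trans (le_of_eq ?_)
      field_simp
    have h2' : |∫ s in M..hi, f s| ≤ (W * X₀ * Mρ) * (lo / M ^ 2) := by
      refine h2.trans ?_
      have := mul_le_mul_of_nonneg_left hρ2 (by positivity : 0 ≤ W * X₀ * (1 / lo ^ 2))
      refine this.trans (le_of_eq ?_)
      field_simp
    calc |(∫ s in lo..M, f s) + ∫ s in M..hi, f s| ≤ |∫ s in lo..M, f s| + |∫ s in M..hi, f s| := abs_add_le _ _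
      _ ≤ 4 * (W * X₀ * Mρ) * (lo / M ^ 2) + (W * X₀ * Mρ) * (lo / M ^ 2) := add_le_add h1' h2'
      _ = 5 * (W * X₀ * Mρ) * (lo / M ^ 2) := by ring
  · -- case B: the whole line is below `D` (`hi < M` forces `M = D`)
    have hDlo : lo < D := by
      by_contra h
      have : M = lo := by rw [hM, max_eq_right (not_lt.1 h)]
      linarith
    have hMD : M = D := by rw [hM, max_eq_left hDlo.le]
    have h1 : |∫ s in lo..hi, f s| ≤ W * X₀ * (4 / M ^ 2) * ∫ s in lo..hi, ρ s :=
      hcmp lo hi _ le_rfl hlohi le_rfl (by positivity) fun s hs => hpt1 s hs (Or.inl (by linarith [hs.2]))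
    refine h1.trans ?_
    have := mul_le_mul_of_nonneg_left hmass (by positivity : 0 ≤ W * X₀ * (4 / M ^ 2))
    refine this.trans ?_
    have h4 : W * X₀ * (4 / M ^ 2) * (Mρ * lo) = 4 * (W * X₀ * Mρ) * (lo / M ^ 2) := by field_simp
    rw [h4]
    nlinarith

/-! ## §3 A bound uniform in the lower endpoint passes to the endpoint (the `lo`-free laws reach the Fermi level) -/

/-- **UNIFORM IN THE LOWER ENDPOINT ⟹ AT THE ENDPOINT.**  `a < c ≤ b`, `f` interval-integrable on `[a,b]`, and `∫_t^b f ≤ C` for every `t ∈ (a, c]`.  THEN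
`∫_a^b f ≤ C`.  Use: the two-sided and post laws of parts 4a/4b (`…C4aFoldBoxPartnerBandLaws`, `…PostLaws`) and their `_below` twins are `lo`-FREE, so they bound
the level layer `∫_{lo′..hi} w·|∫dv …|` for every `lo′ > 0` by the same number; this lemma carries the bound to `lo′ = 0`, i.e. to the whole half tube section
`[0, hi]` — the Fermi strip costs nothing on those two sides (continuity of the primitive; no kernel input at `e = 0`). [folklore] -/
theorem intervalIntegral_le_of_forall_Ioc_left {f : ℝ → ℝ} {a b c C : ℝ} (hac : a < c) (hcb : c ≤ b) (hfi : IntervalIntegrable f volume a b)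
    (h : ∀ t ∈ Ioc a c, ∫ x in t..b, f x ≤ C) : ∫ x in a..b, f x ≤ C := by
  have hab : a ≤ b := hac.le.trans hcb
  -- the primitive from the left endpoint is continuous on `[a,b]`
  have hint : IntegrableOn f (uIcc a b) volume := by
    rw [uIcc_of_le hab]; exact (intervalIntegrable_iff_integrableOn_Icc_of_le hab).1 hfi
  have hprim : ContinuousOn (fun t => ∫ x in a..t, f x) (uIcc a b) := intervalIntegral.continuousOn_primitive_interval hint
  -- `g t = ∫_t^b f = ∫_a^b f − ∫_a^t f` on `[a,b]`
  set g : ℝ → ℝ := fun t => (∫ x in a..b, f x) - ∫ x in a..t, f x with hg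
  have hgc : ContinuousOn g (Icc a b) := by
    rw [← uIcc_of_le hab]; exact continuousOn_const.sub hprim
  have hg_eq : ∀ t ∈ Icc a b, g t = ∫ x in t..b, f x := fun t ht => by
    have hft : IntervalIntegrable f volume a t := hfi.mono_set (by rw [uIcc_of_le hab, uIcc_of_le ht.1]; exact Icc_subset_Icc le_rfl ht.2)
    have htb : IntervalIntegrable f volume t b := hfi.mono_set (by rw [uIcc_of_le hab, uIcc_of_le ht.2]; exact Icc_subset_Icc ht.1 le_rfl)
    rw [hg]
    simp only
    rw [← intervalIntegral.integral_add_adjacent_intervals hft htb]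
    ring
  have hga : g a = ∫ x in a..b, f x := by rw [hg]; simp
  -- pass to the limit `t → a⁺` inside `(a, c)`
  haveI : (nhdsWithin a (Ioo a c)).NeBot := left_nhdsWithin_Ioo_neBot hac
  have hcw : ContinuousWithinAt g (Ioo a c) a :=
    ((hgc a (left_mem_Icc.2 hab)).mono (Ioo_subset_Icc_self.trans (Icc_subset_Icc le_rfl hcb)))
  have hev : ∀ᶠ t in nhdsWithin a (Ioo a c), g t ≤ C := eventually_nhdsWithin_of_forall fun t ht => by
    rw [hg_eq t ⟨ht.1.le, ht.2.le.trans hcb⟩]; exact h t ⟨ht.1, ht.2.le⟩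
  have hlim := le_of_tendsto hcw.tendsto hev
  rwa [hga] at hlim

end Summit.HubbardSuperconductivity.HubbardSuperconductivity.Theorems.C4a

end
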